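import Literature.Probability.RandomPlanarGeometry.SAWCountZdSymbolSplitRun
import HarnessLib

/-!
# SIX-RUN SHAPE CLASSES (`m = 2j`): three one-block windows and the four PURE HEXADS — `#six(s) + 2(2j−7)‼2^{2j−3} = 3(2j−5)‼2^{2j−2} + 4(2j−7)‼2^{2j−3}`

Topic `Literature/Probability/RandomPlanarGeometry` (the «SYMBOL POLYNOMIALITY» programme, third layer; on `SAWCountZdSymbolFiveRun.lean` (a-p1 g26: `fiveVec`,
`mem_fiveVec_of_mem_topVec_left/right`, `disjoint_topVec_topVec_succ`, `mem_shapeClass_iff`), `SAWCountZdSymbolSplitRun.lean` (a-p1 g26: the reversal-pair count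
`card_revPairs_eq_card_revData` + `card_revData` = `(2j−7)‼2^{2j−3}`), λ1 `SAWCountZdSymbolTopShapes.lean` (`topVec`, `top_block`, `axCls`, `card_axCls_eq_two`, `not_three_axCls`),
λ3 `SAWCountZdSymbolTopCount.lean` (`card_shapeClass_top`), a-p3 g18's type calculus (`canon`, `SameType`, `sameType_canon`, `SameType.comp`, `canon_canon`)).

PRINTED CONTEXT (locators only; nothing is quoted digit-for-digit). Madras–Slade (1993) §1.1 eq. (1.1.8) p. 5, Definition 1.2.4, §1.2 p. 10; Clisby–Liang–Slade (2007)
§3.3 eqs. (29)/(31); Glimm–Jaffe (1987) (3.2.13). NOT IN PRINT as far as the lane's desks could locate: the statements below (lane theorems about the lane's shape classes).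

THE THEOREM. On `m = 2j` letters (every axis exactly twice) the SIX-RUN vector `sixRunVec m s` (adjacencies `s, …, s+4`; run type `{6}`, the first of the four run types of
the third-layer top corner `T'_j`) has the class ★★ `card_shapeClass_sixRunVec`: **`#shapeClass j (2j) (sixRunVec (2j) s) + 2·(2j−7)‼·2^{2j−3} = 3·(2j−5)‼·2^{2j−2} +
4·(2j−7)‼·2^{2j−3}`** (`= (3a + b)·2^{2j−2}`, `a = (2j−5)‼`, `b = (2j−7)‼`; `640, 12288` per six-run at `j = 4, 5`). MECHANISM: a member's zero block in the run has
length `4` (offset `0, 1, 2`: the three one-block classes, pairwise disjoint, the outer two losing the reversal pairs at the far end of the run — `inter_sixRunVec_topVec_*`) or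
it is the whole run with NO zero window of length four: a PURE HEXAD. ★★ `hexad_patterns` — a pure hexad pairs the six positions into opposite letters along one of
the FOUR patterns `{0,3}{1,4}{2,5}`, `{0,2}{1,4}{3,5}`, `{0,4}{1,3}{2,5}`, `{0,3}{1,5}{2,4}` (the non-adjacent perfect matchings of six points in a row are five; `{0,5}{1,3}{2,4}`
has the zero window `[1,5)`); ★★ `card_filter_pairs_of_perm` — a POSITION PERMUTATION `σ` transports `κ ↦ canon (κ ∘ σ)` bijectively on the canonical all-twice words and
carries prescribed opposite pairs to prescribed opposite pairs, so every pattern has the count of the reference pattern `{0,2}{1,3}{4,5}` = «one-block class with a reversal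
at `(s+4, s+5)`» = `(2j−7)‼·2^{2j−3}` (6b). Tool notions (the lane's): `sixRunVec`, `baseClass`, `OppAt`.

THIS FILE (lane «pcv-sawmu», a-p1 g27; all PROVED, standard axioms): `sixRunVec`, `sixRunVec_eq_true_iff`, `adjValid_sixRunVec`, `breaks_sixRunVec`, `baseClass`, `mem_baseClass_of_mem`,
`OppAt`, `oppAt_iff`, `exists_opp_of_bsumW_eq_zero`, `card_axCls_eq_two_of_base`, `eq_or_eq_of_oppAt`, `twoStepV_add_of_oppAt`, ★ `mem_topVec_of_oppAt`,
`card_filter_eq_of_leftInv'` (private), `SameType.oppAt_iff`, ★★ `card_filter_pairs_of_perm`, ★ `card_filter_ref_pairs`, ★ `card_filter_three_pairs`,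
`mem_sixRunVec_iff_of_mem_topVec_left`, `mem_sixRunVec_of_mem_topVec_mid`, `mem_sixRunVec_iff_of_mem_topVec_right`, `mem_topVec_of_mem_sixRunVec`, `disjoint_topVec_topVec_two`,
★★ `hexad_patterns`, ★ `hexad_mem_sixRunVec`, `oppAt_unique`, `oppAt_symm`, ★★ `card_hexads`, ★★★ `card_shapeClass_sixRunVec`.
[cite: MadrasSlade1993, §1.1 eq. (1.1.8) p. 5; Definition 1.2.4; §1.2 (p. 10)] [cite: ClisbyLiangSlade2007, §3.3 eqs. (29)/(31)] [cite: GlimmJaffeQP1987, (3.2.13) §3.2]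

Provenance: lane «pcv-sawmu», a-p1 g27 (2026-08-28).
-/

open Finset
open scoped BigOperators
open Literature.Probability.LatticeModels
open Literature.Probability.RandomPlanarGeometry.SAW
open Literature.Probability.Percolation
open Literature.MathematicalPhysics.QuantumFieldTheory.Balaban1983to89
open Literature.MathematicalPhysics.QuantumFieldTheory.Balaban1983to89.HiggsFluctMeasureWickPairings

namespace Literature.Probability.RandomPlanarGeometry.SAW.Zd

namespace WordTypes

variable {m : ℕ}

/-! ### The six-run vector -/

/-- The SIX-RUN adjacency vector `sixRunVec`: adjacencies at `s, …, s+4` (one run `[s, s+6)`). [cite: MadrasSlade1993, Definition 1.2.4; lane tool notion] -/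
def sixRunVec (m s : ℕ) : Fin m → Bool := fun k => decide (s ≤ k.val ∧ k.val ≤ s + 4)

/-- `sixRunVec m s k = true ↔ s ≤ k ≤ s + 4`. [cite: MadrasSlade1993, Definition 1.2.4; lane plumbing] -/
theorem sixRunVec_eq_true_iff {m s : ℕ} (k : Fin m) : sixRunVec m s k = true ↔ s ≤ k.val ∧ k.val ≤ s + 4 := by
  simp [sixRunVec]

/-- `sixRunVec m s` is valid when `s + 6 ≤ m`. [cite: MadrasSlade1993, Definition 1.2.4; lane plumbing] -/
theorem adjValid_sixRunVec {m s : ℕ} (hs : s + 6 ≤ m) : AdjValid (sixRunVec m s) := by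
  intro h
  rw [Bool.eq_false_iff, Ne, sixRunVec_eq_true_iff]
  simp only
  omega

open Classical in
/-- `sixRunVec m s` has five adjacencies, hence `m − 5` breaks (`s + 6 ≤ m`). [cite: MadrasSlade1993, Definition 1.2.4; lane plumbing] -/
theorem breaks_sixRunVec {m s : ℕ} (hs : s + 6 ≤ m) : breaks (sixRunVec m s) = m - 5 := by
  unfold breaks
  have htrue : (Finset.univ.filter fun k : Fin m => sixRunVec m s k = true) =
      {⟨s, by omega⟩, ⟨s + 1, by omega⟩, ⟨s + 2, by omega⟩, ⟨s + 3, by omega⟩, ⟨s + 4, by omega⟩} := by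
    ext k
    rw [Finset.mem_filter, sixRunVec_eq_true_iff]
    simp only [Finset.mem_univ, true_and, Finset.mem_insert, Finset.mem_singleton, Fin.ext_iff]
    omega
  have h5 : (Finset.univ.filter fun k : Fin m => sixRunVec m s k = true).card = 5 := by
    rw [htrue, Finset.card_insert_of_notMem (by simp [Fin.ext_iff]), Finset.card_insert_of_notMem (by simp [Fin.ext_iff]),
      Finset.card_insert_of_notMem (by simp [Fin.ext_iff]), Finset.card_pair (by simp [Fin.ext_iff])]
  have hsum := Finset.card_filter_add_card_filter_not (s := (Finset.univ : Finset (Fin m))) (fun k : Fin m => sixRunVec m s k = true)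
  simp only [Finset.card_univ, Fintype.card_fin, Bool.not_eq_true] at hsum
  omega

/-! ### The base class and opposite pairs -/

open Classical in
/-- The BASE CLASS: canonical words of length `m` on `m − j` axes with every position repeated (no run conditions).
[cite: MadrasSlade1993, Definition 1.2.4; lane tool notion] -/
noncomputable def baseClass (j m : ℕ) : Finset (Word m m) :=
  Finset.univ.filter fun κ => canon κ = κ ∧ numAxes κ + j = m ∧ ∀ i, IsRep κ i

/-- A class member is a base member. [cite: MadrasSlade1993, Definition 1.2.4; lane plumbing] -/
theorem mem_baseClass_of_mem {j : ℕ} {A : Fin m → Bool} {κ : Word m m} (hκ : κ ∈ shapeClass j m A) : κ ∈ baseClass j m := by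
  classical
  rw [mem_shapeClass_iff] at hκ
  unfold baseClass
  rw [Finset.mem_filter]
  exact ⟨Finset.mem_univ _, hκ.1, hκ.2.1, hκ.2.2.1⟩

/-- `OppAt κ u v`: the letter at `v` is the opposite (same axis, flipped sign) of the letter at `u`. [cite: MadrasSlade1993, Definition 1.2.4; lane tool notion] -/
def OppAt (κ : Word m m) (u v : Fin m) : Prop := κ v = ((κ u).1, !(κ u).2)

/-- `OppAt` is decidable (it is an equality of letters). [cite: MadrasSlade1993, Definition 1.2.4; lane plumbing] -/
theorem oppAt_iff (κ : Word m m) (u v : Fin m) : OppAt κ u v ↔ κ v = ((κ u).1, !(κ u).2) := Iff.rfl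

/-- In a zero block every letter has its opposite inside the block. [cite: MadrasSlade1993, Definition 1.2.4; lane lemma] -/
theorem exists_opp_of_bsumW_eq_zero (κ : Word m m) {i i' : ℕ} (hz : bsumW κ i i' = 0) (q : Fin m) (hq : i ≤ q.val ∧ q.val < i') :
    ∃ q' : Fin m, (i ≤ q'.val ∧ q'.val < i') ∧ q' ≠ q ∧ OppAt κ q q' := by
  classical
  unfold bsumW at hz
  rw [sum_twoStepV_eq_zero_iff] at hz
  have hx := hz (κ q).1
  have hqt : q ∈ Finset.univ.filter (fun r : Fin m => i ≤ r.val ∧ r.val < i') := Finset.mem_filter.2 ⟨Finset.mem_univ _, hq⟩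
  have hne : ((Finset.univ.filter (fun r : Fin m => i ≤ r.val ∧ r.val < i')).filter fun r => κ r = ((κ q).1, !(κ q).2)).Nonempty := by
    rw [← Finset.card_pos]
    cases hs : (κ q).2
    · have hmem : q ∈ (Finset.univ.filter (fun r : Fin m => i ≤ r.val ∧ r.val < i')).filter fun r => κ r = ((κ q).1, false) :=
        Finset.mem_filter.2 ⟨hqt, Prod.ext rfl hs⟩
      have hpos := Finset.card_pos.2 ⟨q, hmem⟩
      simp only [Bool.not_false]
      omega
    · have hmem : q ∈ (Finset.univ.filter (fun r : Fin m => i ≤ r.val ∧ r.val < i')).filter fun r => κ r = ((κ q).1, true) :=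
        Finset.mem_filter.2 ⟨hqt, Prod.ext rfl hs⟩
      have hpos := Finset.card_pos.2 ⟨q, hmem⟩
      simp only [Bool.not_true]
      omega
  obtain ⟨q', hq'⟩ := hne
  rw [Finset.mem_filter] at hq'
  refine ⟨q', (Finset.mem_filter.1 hq'.1).2, ?_, hq'.2⟩
  rintro rfl
  have := congrArg Prod.snd hq'.2
  cases h : (κ q').2 <;> simp [h] at this

open Classical in
/-- Every axis occurs exactly twice in a base member (`m = 2j`). [cite: MadrasSlade1993, Definition 1.2.4; lane lemma] -/
theorem card_axCls_eq_two_of_base {j : ℕ} (hm : m = 2 * j) {κ : Word m m} (hκ : κ ∈ baseClass j m) (q : Fin m) : (axCls κ q).card = 2 := by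
  unfold baseClass at hκ
  rw [Finset.mem_filter] at hκ
  obtain ⟨-, -, hax, hrep⟩ := hκ
  have hI : (Finset.univ.image fun q : Fin m => (κ q).1).card = j := by rw [← numAxes_eq_card_image]; omega
  have hge : ∀ x ∈ Finset.univ.image (fun q : Fin m => (κ q).1), 2 ≤ (Finset.univ.filter fun q' : Fin m => (κ q').1 = x).card := by
    intro x hx
    obtain ⟨q0, -, rfl⟩ := Finset.mem_image.1 hx
    obtain ⟨q1, hq1, h1⟩ := hrep q0
    have hsub : ({q0, q1} : Finset (Fin m)) ⊆ Finset.univ.filter fun q' => (κ q').1 = (κ q0).1 := by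
      intro x hx
      rw [Finset.mem_insert, Finset.mem_singleton] at hx
      rw [Finset.mem_filter]
      rcases hx with rfl | rfl
      · exact ⟨Finset.mem_univ _, rfl⟩
      · exact ⟨Finset.mem_univ _, h1⟩
    have := Finset.card_le_card hsub
    rwa [Finset.card_pair hq1.symm] at this
  have hsum := Finset.card_eq_sum_card_image (fun q : Fin m => (κ q).1) Finset.univ
  rw [Finset.card_univ, Fintype.card_fin] at hsum
  by_contra hne
  have h2 := hge (κ q).1 (Finset.mem_image_of_mem _ (Finset.mem_univ q))
  have h3 : 3 ≤ (Finset.univ.filter fun q' : Fin m => (κ q').1 = (κ q).1).card := by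
    unfold axCls at hne; omega
  have hlt : ∑ x ∈ Finset.univ.image (fun q : Fin m => (κ q).1), 2 <
      ∑ x ∈ Finset.univ.image (fun q : Fin m => (κ q).1), (Finset.univ.filter fun q' : Fin m => (κ q').1 = x).card :=
    Finset.sum_lt_sum hge ⟨(κ q).1, Finset.mem_image_of_mem _ (Finset.mem_univ q), h3⟩
  rw [Finset.sum_const, smul_eq_mul, hI] at hlt
  omega

/-- The partner is unique: if `v` is opposite to `u`, every position on the axis of `u` is `u` or `v` (`m = 2j`). [cite: MadrasSlade1993, Definition 1.2.4; lane lemma] -/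
theorem eq_or_eq_of_oppAt {j : ℕ} (hm : m = 2 * j) {κ : Word m m} (hκ : κ ∈ baseClass j m) {u v c : Fin m} (huv : OppAt κ u v)
    (hc : (κ c).1 = (κ u).1) : c = u ∨ c = v := by
  classical
  have hvu : v ≠ u := by
    rintro rfl; unfold OppAt at huv
    have := congrArg Prod.snd huv
    cases h : (κ v).2 <;> simp [h] at this
  have h2 := card_axCls_eq_two_of_base hm hκ u
  have hsub : ({u, v} : Finset (Fin m)) ⊆ axCls κ u := by
    intro x hx
    rw [Finset.mem_insert, Finset.mem_singleton] at hx
    rcases hx with rfl | rfl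
    · exact self_mem_axCls κ x
    · unfold OppAt at huv; exact mem_axCls.2 (by rw [huv])
  have heq : ({u, v} : Finset (Fin m)) = axCls κ u := Finset.eq_of_subset_of_card_le hsub (by rw [h2, Finset.card_pair hvu.symm])
  have : c ∈ axCls κ u := mem_axCls.2 hc
  rw [← heq, Finset.mem_insert, Finset.mem_singleton] at this
  exact this

/-- Opposite letters sum to zero as transverse steps. [cite: MadrasSlade1993, Definition 1.2.4; lane plumbing] -/
theorem twoStepV_add_of_oppAt {κ : Word m m} {u v : Fin m} (h : OppAt κ u v) : twoStepV m (κ u) + twoStepV m (κ v) = 0 := by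
  unfold OppAt at h
  rw [h, show ((κ u).1, !(κ u).2) = revIdx (κ u) from rfl, twoStepV_revIdx, add_neg_cancel]

/-- ★ A base member whose window `[t, t+4)` reads `x y x̄ ȳ` lies in the one-block class at `t` (`m = 2j`): the three no-reversal conditions follow from «no third
occurrence». [cite: MadrasSlade1993, Definition 1.2.4; lane lemma] -/
theorem mem_topVec_of_oppAt {j t : ℕ} (hm : m = 2 * j) (ht : t + 4 ≤ m) {κ : Word m m} (hκ : κ ∈ baseClass j m)
    (h02 : OppAt κ ⟨t, by omega⟩ ⟨t + 2, by omega⟩) (h13 : OppAt κ ⟨t + 1, by omega⟩ ⟨t + 3, by omega⟩) :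
    κ ∈ shapeClass j m (topVec m t) := by
  classical
  have hκ' := hκ
  unfold baseClass at hκ'
  rw [Finset.mem_filter] at hκ'
  obtain ⟨-, hcan, hax, hrep⟩ := hκ'
  have ht0 : t < m := by omega
  have ht1 : t + 1 < m := by omega
  have ht2 : t + 2 < m := by omega
  have ht3 : t + 3 < m := by omega
  -- the two block axes differ: else four occurrences
  have hne : (κ ⟨t, ht0⟩).1 ≠ (κ ⟨t + 1, ht1⟩).1 := by
    intro h
    rcases eq_or_eq_of_oppAt hm hκ h02 h.symm with h1 | h1 <;> simp [Fin.ext_iff] at h1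
  have hax2 : (κ ⟨t + 2, ht2⟩).1 = (κ ⟨t, ht0⟩).1 := by unfold OppAt at h02; rw [h02]
  have hax3 : (κ ⟨t + 3, ht3⟩).1 = (κ ⟨t + 1, ht1⟩).1 := by unfold OppAt at h13; rw [h13]
  rw [mem_shapeClass_iff]
  refine ⟨hcan, hax, hrep, fun k hk hAk => ?_, ⟨t, t + 4, by omega, ht, fun k hk hk' => (topVec_eq_true_iff k).2 ⟨hk, by omega⟩, ?_⟩⟩
  · rw [topVec_eq_true_iff] at hAk
    intro heq
    have hax' : (κ ⟨k.val + 1, hk⟩).1 = (κ k).1 := by rw [heq]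
    have hk3 : k.val = t ∨ k.val = t + 1 ∨ k.val = t + 2 := by omega
    rcases hk3 with h | h | h
    · have e0 : k = ⟨t, ht0⟩ := Fin.ext h
      have e1 : (⟨k.val + 1, hk⟩ : Fin m) = ⟨t + 1, ht1⟩ := Fin.ext (by simp only; omega)
      rw [e1, e0] at hax'
      exact hne hax'.symm
    · have e0 : k = ⟨t + 1, ht1⟩ := Fin.ext h
      have e1 : (⟨k.val + 1, hk⟩ : Fin m) = ⟨t + 2, ht2⟩ := Fin.ext (by simp only; omega)
      rw [e1, e0, hax2] at hax'
      exact hne hax'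
    · have e0 : k = ⟨t + 2, ht2⟩ := Fin.ext h
      have e1 : (⟨k.val + 1, hk⟩ : Fin m) = ⟨t + 3, ht3⟩ := Fin.ext (by simp only; omega)
      rw [e1, e0, hax2, hax3] at hax'
      exact hne hax'.symm
  · rw [wordPos_eq_iff_bsumW κ (by omega) ht, bsumW_succ κ (by omega) (by omega), bsumW_succ κ (by omega) (by omega),
      bsumW_succ κ (by omega) (by omega), bsumW_succ κ (by omega) (by omega), bsumW_self, zero_add]
    have h1 := twoStepV_add_of_oppAt h02
    have h2 := twoStepV_add_of_oppAt h13
    calc twoStepV m (κ ⟨t, ht0⟩) + twoStepV m (κ ⟨t + 1, ht1⟩) + twoStepV m (κ ⟨t + 2, ht2⟩) + twoStepV m (κ ⟨t + 3, ht3⟩)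
        = (twoStepV m (κ ⟨t, ht0⟩) + twoStepV m (κ ⟨t + 2, ht2⟩)) + (twoStepV m (κ ⟨t + 1, ht1⟩) + twoStepV m (κ ⟨t + 3, ht3⟩)) := by abel
      _ = 0 := by rw [h1, h2, add_zero]

/-! ### ★★ Transport by a position permutation -/

/-- A map into `t` with a left inverse on `s` and `#s = #t` is a bijection; filtered cardinalities agree for corresponding predicates.
[cite: MadrasSlade1993, Definition 1.2.4; lane plumbing] -/
private theorem card_filter_eq_of_leftInv' {α : Type*} [DecidableEq α] {s : Finset α} (i g : α → α) (hi : ∀ a ∈ s, i a ∈ s)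
    (hleft : ∀ a ∈ s, g (i a) = a) (P Q : α → Prop) [DecidablePred P] [DecidablePred Q] (hPQ : ∀ a ∈ s, P a ↔ Q (i a)) :
    (s.filter Q).card = (s.filter P).card := by
  have hinj : Set.InjOn i s := fun a ha b hb h => by
    have := congrArg g h
    rwa [hleft a (Finset.mem_coe.1 ha), hleft b (Finset.mem_coe.1 hb)] at this
  have himg : s.image i = s :=
    Finset.eq_of_subset_of_card_le (Finset.image_subset_iff.2 hi) (by rw [Finset.card_image_of_injOn hinj])
  have hfilt : (s.filter P).image i = s.filter Q := by
    ext b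
    rw [Finset.mem_image, Finset.mem_filter]
    constructor
    · rintro ⟨a, ha, rfl⟩
      rw [Finset.mem_filter] at ha
      exact ⟨hi a ha.1, (hPQ a ha.1).1 ha.2⟩
    · rintro ⟨hb, hQ⟩
      have hb' : b ∈ s.image i := by rw [himg]; exact hb
      obtain ⟨a, ha, rfl⟩ := Finset.mem_image.1 hb'
      exact ⟨a, Finset.mem_filter.2 ⟨ha, (hPQ a ha).2 hQ⟩, rfl⟩
  rw [← hfilt, Finset.card_image_of_injOn (fun a ha b hb h =>
    hinj (Finset.mem_filter.1 (Finset.mem_coe.1 ha)).1 (Finset.mem_filter.1 (Finset.mem_coe.1 hb)).1 h)]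

/-- `OppAt` is a type invariant. [cite: MadrasSlade1993, Definition 1.2.4; lane plumbing] -/
theorem SameType.oppAt_iff {w w' : Word m m} (h : SameType w w') (u v : Fin m) : OppAt w u v ↔ OppAt w' u v := by
  unfold OppAt
  rw [Prod.ext_iff, Prod.ext_iff, h.1 v u, h.2 v, h.2 u]

open Classical in
/-- ★★ TRANSPORT BY A POSITION PERMUTATION: for `σ ∈ Sym(Fin m)`, the base members with three prescribed opposite pairs `(σ uᵢ, σ vᵢ)` are as many as those with the
pairs `(uᵢ, vᵢ)` — `κ ↦ canon (κ ∘ σ)` is a bijection of the base class (inverse `κ ↦ canon (κ ∘ σ⁻¹)`) carrying one condition to the other.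
[cite: MadrasSlade1993, Definition 1.2.4; lane theorem] -/
theorem card_filter_pairs_of_perm {j : ℕ} (σ : Equiv.Perm (Fin m)) (u₁ v₁ u₂ v₂ u₃ v₃ : Fin m) :
    ((baseClass j m).filter fun κ => OppAt κ (σ u₁) (σ v₁) ∧ OppAt κ (σ u₂) (σ v₂) ∧ OppAt κ (σ u₃) (σ v₃)).card =
      ((baseClass j m).filter fun κ => OppAt κ u₁ v₁ ∧ OppAt κ u₂ v₂ ∧ OppAt κ u₃ v₃).card := by
  classical
  -- generic facts about `κ ↦ canon (κ ∘ τ)`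
  have himg : ∀ (τ : Equiv.Perm (Fin m)) (κ : Word m m), (Finset.univ.image fun p : Fin m => ((κ ∘ τ) p).1) = Finset.univ.image fun p => (κ p).1 := by
    intro τ κ; ext x
    simp only [Finset.mem_image, Finset.mem_univ, true_and, Function.comp]
    exact ⟨fun ⟨p, hp⟩ => ⟨τ p, hp⟩, fun ⟨p, hp⟩ => ⟨τ.symm p, by simpa using hp⟩⟩
  have hrep : ∀ (τ : Equiv.Perm (Fin m)) (κ : Word m m) (i : Fin m), IsRep (κ ∘ τ) i ↔ IsRep κ (τ i) := by
    intro τ κ i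
    constructor
    · rintro ⟨q, hq, h⟩; exact ⟨τ q, fun h' => hq (τ.injective h'), h⟩
    · rintro ⟨q, hq, h⟩; exact ⟨τ.symm q, fun h' => hq (by rw [← h']; simp), by simpa [Function.comp] using h⟩
  have hmem : ∀ (τ : Equiv.Perm (Fin m)) (κ : Word m m), κ ∈ baseClass j m → canon (κ ∘ τ) ∈ baseClass j m := by
    intro τ κ hκ
    unfold baseClass at hκ ⊢
    rw [Finset.mem_filter] at hκ ⊢
    obtain ⟨-, -, hax, hrp⟩ := hκ
    have hst := sameType_canon (κ ∘ τ)
    refine ⟨Finset.mem_univ _, canon_canon _, ?_, fun i => (hst.isRep_iff i).1 ((hrep τ κ i).2 (hrp (τ i)))⟩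
    rw [numAxes_canon, numAxes_eq_card_image, himg, ← numAxes_eq_card_image]; exact hax
  have hleft : ∀ (τ : Equiv.Perm (Fin m)) (κ : Word m m), κ ∈ baseClass j m → canon (canon (κ ∘ τ) ∘ τ.symm) = κ := by
    intro τ κ hκ
    unfold baseClass at hκ
    rw [Finset.mem_filter] at hκ
    have hst : SameType ((κ ∘ τ) ∘ τ.symm) (canon (κ ∘ τ) ∘ τ.symm) := (sameType_canon (κ ∘ τ)).comp τ.symm
    have hid : (κ ∘ τ) ∘ τ.symm = κ := by funext p; simp [Function.comp]
    rw [hid] at hst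
    rw [← hst.canon_eq, hκ.2.1]
  refine card_filter_eq_of_leftInv' (fun κ => canon (κ ∘ σ.symm)) (fun κ => canon (κ ∘ σ)) (fun κ hκ => hmem σ.symm κ hκ)
    (fun κ hκ => by simpa using hleft σ.symm κ hκ) _ _ (fun κ _ => ?_)
  have hst := sameType_canon (κ ∘ σ.symm)
  rw [← hst.oppAt_iff, ← hst.oppAt_iff, ← hst.oppAt_iff]
  simp only [OppAt, Function.comp, Equiv.symm_apply_apply]

/-! ### ★ The reference pattern `{0,2}{1,3}{4,5}`: a one-block class with a reversal at its far end -/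

section Ref

variable {j s : ℕ}

open Classical in
/-- ★ THE REFERENCE COUNT: base members with `x y x̄ ȳ` on `[s, s+4)` and a reversal at `(s+4, s+5)` number `(2j−7)‼·2^{2j−3}` (`m = 2j`, `j ≥ 3`, `s + 6 ≤ m`) — they are
the reversal pairs of the one-block class at `s` (6b). [cite: MadrasSlade1993, Definition 1.2.4; lane theorem] -/
theorem card_filter_ref_pairs (hm : m = 2 * j) (hj : 3 ≤ j) (hs : s + 6 ≤ m) :
    ((baseClass j m).filter fun κ => OppAt κ ⟨s, by omega⟩ ⟨s + 2, by omega⟩ ∧ OppAt κ ⟨s + 1, by omega⟩ ⟨s + 3, by omega⟩ ∧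
        OppAt κ ⟨s + 4, by omega⟩ ⟨s + 5, by omega⟩).card = (2 * j - 7).doubleFactorial * 2 ^ (2 * j - 3) := by
  classical
  have hq : SepAdj m s (s + 4) := ⟨Or.inr le_rfl, by omega⟩
  have heq : ((baseClass j m).filter fun κ => OppAt κ ⟨s, by omega⟩ ⟨s + 2, by omega⟩ ∧ OppAt κ ⟨s + 1, by omega⟩ ⟨s + 3, by omega⟩ ∧
      OppAt κ ⟨s + 4, by omega⟩ ⟨s + 5, by omega⟩) =
      (shapeClass j m (topVec m s)).filter fun κ => κ ⟨s + 4 + 1, by omega⟩ = ((κ ⟨s + 4, by omega⟩).1, !(κ ⟨s + 4, by omega⟩).2) := by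
    ext κ
    rw [Finset.mem_filter, Finset.mem_filter]
    have e45 : (⟨s + 4 + 1, by omega⟩ : Fin m) = ⟨s + 5, by omega⟩ := Fin.ext (show s + 4 + 1 = s + 5 by omega)
    rw [e45]
    constructor
    · rintro ⟨hκ, h02, h13, h45⟩
      exact ⟨mem_topVec_of_oppAt hm (by omega) hκ h02 h13, h45⟩
    · rintro ⟨hκ, h45⟩
      obtain ⟨a2, a3, -⟩ := top_block hm hκ (by omega)
      exact ⟨mem_baseClass_of_mem hκ, a2, a3, h45⟩
  rw [heq, card_revPairs_eq_card_revData hm (by omega) hq, card_revData hm hj (by omega) hq]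

open Classical in
/-- ★ EVERY PATTERN REACHED BY A PERMUTATION OF THE SIX POSITIONS HAS THE REFERENCE COUNT (`m = 2j`, `j ≥ 3`, `s + 6 ≤ m`).
[cite: MadrasSlade1993, Definition 1.2.4; lane theorem] -/
theorem card_filter_three_pairs (hm : m = 2 * j) (hj : 3 ≤ j) (hs : s + 6 ≤ m) (σ : Equiv.Perm (Fin m)) :
    ((baseClass j m).filter fun κ => OppAt κ (σ ⟨s, by omega⟩) (σ ⟨s + 2, by omega⟩) ∧ OppAt κ (σ ⟨s + 1, by omega⟩) (σ ⟨s + 3, by omega⟩) ∧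
        OppAt κ (σ ⟨s + 4, by omega⟩) (σ ⟨s + 5, by omega⟩)).card = (2 * j - 7).doubleFactorial * 2 ^ (2 * j - 3) := by
  rw [card_filter_pairs_of_perm, card_filter_ref_pairs hm hj hs]

end Ref

/-! ### The three one-block windows of a six-run -/

section Windows

variable {j s : ℕ}

/-- A one-block member at offset `0` is a six-run member iff it has no reversal at `(s+4, s+5)` (`m = 2j`). [cite: MadrasSlade1993, Definition 1.2.4; lane lemma] -/
theorem mem_sixRunVec_iff_of_mem_topVec_left (hm : m = 2 * j) (hs : s + 6 ≤ m) {κ : Word m m} (hκ : κ ∈ shapeClass j m (topVec m s)) :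
    κ ∈ shapeClass j m (sixRunVec m s) ↔ ¬ κ ⟨s + 4 + 1, by omega⟩ = ((κ ⟨s + 4, by omega⟩).1, !(κ ⟨s + 4, by omega⟩).2) := by
  have h5 := mem_fiveVec_of_mem_topVec_left hm (by omega) hκ
  rw [mem_shapeClass_iff] at h5
  obtain ⟨hcan, hax, hrep, hnr5, a, a', haa', ha', hA, hpos⟩ := h5
  constructor
  · intro h6
    have hnr6 := (mem_shapeClass_iff.1 h6).2.2.2.1
    exact hnr6 ⟨s + 4, by omega⟩ (by simp only; omega) ((sixRunVec_eq_true_iff _).2 ⟨by simp only; omega, by simp only; omega⟩)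
  · intro h45
    have hs4 : s + 4 < m := by omega
    rw [mem_shapeClass_iff]
    refine ⟨hcan, hax, hrep, fun k hk hAk => ?_, ⟨a, a', haa', ha', fun k hk hk' => ?_, hpos⟩⟩
    · rw [sixRunVec_eq_true_iff] at hAk
      by_cases hk4 : k.val = s + 4
      · have e0 : κ k = κ ⟨s + 4, hs4⟩ := congrArg κ (Fin.ext hk4)
        have e1 : (⟨k.val + 1, hk⟩ : Fin m) = ⟨s + 4 + 1, by omega⟩ := Fin.ext (by simp only; omega)
        rw [e0, e1]; exact h45
      · exact hnr5 k hk ((fiveVec_eq_true_iff k).2 ⟨hAk.1, by omega⟩)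
    · have := hA k hk hk'
      rw [fiveVec_eq_true_iff] at this
      exact (sixRunVec_eq_true_iff k).2 ⟨this.1, by omega⟩

/-- A one-block member at offset `1` is always a six-run member (`m = 2j`): both extra pairs would be third occurrences.
[cite: MadrasSlade1993, Definition 1.2.4; lane lemma] -/
theorem mem_sixRunVec_of_mem_topVec_mid (hm : m = 2 * j) (hs : s + 6 ≤ m) {κ : Word m m} (hκ : κ ∈ shapeClass j m (topVec m (s + 1))) :
    κ ∈ shapeClass j m (sixRunVec m s) := by
  have h5 := mem_fiveVec_of_mem_topVec_right hm (by omega) hκ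
  have h5' := mem_fiveVec_of_mem_topVec_left hm (by omega) hκ
  rw [mem_shapeClass_iff] at h5 h5'
  obtain ⟨hcan, hax, hrep, hnr5, a, a', haa', ha', hA, hpos⟩ := h5
  obtain ⟨-, -, -, hnr5', -⟩ := h5'
  rw [mem_shapeClass_iff]
  refine ⟨hcan, hax, hrep, fun k hk hAk => ?_, ⟨a, a', haa', ha', fun k hk hk' => ?_, hpos⟩⟩
  · rw [sixRunVec_eq_true_iff] at hAk
    by_cases hk4 : k.val = s + 4
    · exact hnr5' k hk ((fiveVec_eq_true_iff k).2 ⟨by omega, by omega⟩)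
    · exact hnr5 k hk ((fiveVec_eq_true_iff k).2 ⟨hAk.1, by omega⟩)
  · have := hA k hk hk'
    rw [fiveVec_eq_true_iff] at this
    exact (sixRunVec_eq_true_iff k).2 ⟨this.1, by omega⟩

/-- A one-block member at offset `2` is a six-run member iff it has no reversal at `(s, s+1)` (`m = 2j`). [cite: MadrasSlade1993, Definition 1.2.4; lane lemma] -/
theorem mem_sixRunVec_iff_of_mem_topVec_right (hm : m = 2 * j) (hs : s + 6 ≤ m) {κ : Word m m} (hκ : κ ∈ shapeClass j m (topVec m (s + 2))) :
    κ ∈ shapeClass j m (sixRunVec m s) ↔ ¬ κ ⟨s + 1, by omega⟩ = ((κ ⟨s, by omega⟩).1, !(κ ⟨s, by omega⟩).2) := by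
  have h5 := mem_fiveVec_of_mem_topVec_right hm (by omega) hκ
  rw [mem_shapeClass_iff] at h5
  obtain ⟨hcan, hax, hrep, hnr5, a, a', haa', ha', hA, hpos⟩ := h5
  constructor
  · intro h6
    have hnr6 := (mem_shapeClass_iff.1 h6).2.2.2.1
    have := hnr6 ⟨s, by omega⟩ (by simp only; omega) ((sixRunVec_eq_true_iff _).2 ⟨le_rfl, by simp only; omega⟩)
    exact this
  · intro h01
    have hs0 : s < m := by omega
    rw [mem_shapeClass_iff]
    refine ⟨hcan, hax, hrep, fun k hk hAk => ?_, ⟨a, a', haa', ha', fun k hk hk' => ?_, hpos⟩⟩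
    · rw [sixRunVec_eq_true_iff] at hAk
      by_cases hk0 : k.val = s
      · have e0 : κ k = κ ⟨s, hs0⟩ := congrArg κ (Fin.ext hk0)
        have e1 : (⟨k.val + 1, hk⟩ : Fin m) = ⟨s + 1, by omega⟩ := Fin.ext (by simp only; omega)
        rw [e0, e1]; exact h01
      · exact hnr5 k hk ((fiveVec_eq_true_iff k).2 ⟨by omega, by omega⟩)
    · have := hA k hk hk'
      rw [fiveVec_eq_true_iff] at this
      exact (sixRunVec_eq_true_iff k).2 ⟨by omega, by omega⟩

/-- A six-run member with a zero window `[t, t+4)` (`t ∈ {s, s+1, s+2}`) lies in the one-block class at `t`. [cite: MadrasSlade1993, Definition 1.2.4; lane lemma] -/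
theorem mem_topVec_of_mem_sixRunVec {t : ℕ} (hs : s + 6 ≤ m) (ht : s ≤ t ∧ t ≤ s + 2) {κ : Word m m} (hκ : κ ∈ shapeClass j m (sixRunVec m s))
    (hz : wordPos κ t = wordPos κ (t + 4)) : κ ∈ shapeClass j m (topVec m t) := by
  rw [mem_shapeClass_iff] at hκ ⊢
  obtain ⟨hcan, hax, hrep, hnr, -⟩ := hκ
  refine ⟨hcan, hax, hrep, fun k hk hAk => hnr k hk ?_, ⟨t, t + 4, by omega, by omega, fun k hk hk' => (topVec_eq_true_iff k).2 ⟨hk, by omega⟩, hz⟩⟩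
  rw [topVec_eq_true_iff] at hAk
  exact (sixRunVec_eq_true_iff k).2 ⟨by omega, by omega⟩

/-- The one-block classes at offsets `0` and `2` of a six-run are disjoint (`m = 2j`): the axis of `s` would sit at `s`, `s+2`, `s+4`.
[cite: MadrasSlade1993, Definition 1.2.4; lane lemma] -/
theorem disjoint_topVec_topVec_two (hm : m = 2 * j) (hs : s + 6 ≤ m) :
    Disjoint (shapeClass j m (topVec m s)) (shapeClass j m (topVec m (s + 2))) := by
  rw [Finset.disjoint_left]
  intro κ h0 h2
  obtain ⟨a2, -, -⟩ := top_block hm h0 (by omega)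
  obtain ⟨b2, -, -⟩ := top_block hm h2 (by omega)
  have e1 : (⟨s + 2 + 2, by omega⟩ : Fin m) = ⟨s + 4, by omega⟩ := Fin.ext (by simp only)
  rw [e1, a2] at b2
  have hax2 : (κ ⟨s + 2, by omega⟩).1 = (κ ⟨s, by omega⟩).1 := by rw [a2]
  have hax4 : (κ ⟨s + 4, by omega⟩).1 = (κ ⟨s, by omega⟩).1 := by rw [b2]
  exact not_three_axCls hm h0 (a := ⟨s, by omega⟩) (b := ⟨s + 2, by omega⟩) (c := ⟨s + 4, by omega⟩)
    (by simp [Fin.ext_iff]) (by simp [Fin.ext_iff]) (by simp [Fin.ext_iff]) hax2 hax4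

end Windows

/-! ### ★★ The pure hexads -/

section Hexads

variable {j s : ℕ}

/-- ★★ THE FOUR HEXAD PATTERNS: a six-run member in none of the three one-block classes pairs the six positions into opposite letters along
`{0,3}{1,4}{2,5}`, `{0,2}{1,4}{3,5}`, `{0,4}{1,3}{2,5}` or `{0,3}{1,5}{2,4}` (`m = 2j`). [cite: MadrasSlade1993, Definition 1.2.4; lane theorem] -/
theorem hexad_patterns (hm : m = 2 * j) (hs : s + 6 ≤ m) {κ : Word m m} (hκ : κ ∈ shapeClass j m (sixRunVec m s))
    (h0 : κ ∉ shapeClass j m (topVec m s)) (h1 : κ ∉ shapeClass j m (topVec m (s + 1))) (h2 : κ ∉ shapeClass j m (topVec m (s + 2))) :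
    (OppAt κ ⟨s, by omega⟩ ⟨s + 3, by omega⟩ ∧ OppAt κ ⟨s + 1, by omega⟩ ⟨s + 4, by omega⟩ ∧ OppAt κ ⟨s + 2, by omega⟩ ⟨s + 5, by omega⟩) ∨
    (OppAt κ ⟨s, by omega⟩ ⟨s + 2, by omega⟩ ∧ OppAt κ ⟨s + 1, by omega⟩ ⟨s + 4, by omega⟩ ∧ OppAt κ ⟨s + 3, by omega⟩ ⟨s + 5, by omega⟩) ∨
    (OppAt κ ⟨s, by omega⟩ ⟨s + 4, by omega⟩ ∧ OppAt κ ⟨s + 1, by omega⟩ ⟨s + 3, by omega⟩ ∧ OppAt κ ⟨s + 2, by omega⟩ ⟨s + 5, by omega⟩) ∨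
    (OppAt κ ⟨s, by omega⟩ ⟨s + 3, by omega⟩ ∧ OppAt κ ⟨s + 1, by omega⟩ ⟨s + 5, by omega⟩ ∧ OppAt κ ⟨s + 2, by omega⟩ ⟨s + 4, by omega⟩) := by
  classical
  have hbase := mem_baseClass_of_mem hκ
  have hκ' := hκ
  rw [mem_shapeClass_iff] at hκ'
  obtain ⟨-, -, -, hnr, a, a', haa', ha', hA, hpos⟩ := hκ'
  have h4 := four_le_of_zero_block _ κ hnr haa' ha' hA hpos
  have hs0 : s < m := by omega
  have hs1 : s + 1 < m := by omega
  have hs2 : s + 2 < m := by omega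
  have hs3 : s + 3 < m := by omega
  have hs4 : s + 4 < m := by omega
  have hs5 : s + 5 < m := by omega
  -- the block lies in `[s, s+6)`: its first and last adjacencies are in the run
  have hA0 := hA ⟨a, by omega⟩ le_rfl (by simp only; omega)
  have hA1 := hA ⟨a' - 2, by omega⟩ (by simp only; omega) (by simp only; omega)
  rw [sixRunVec_eq_true_iff] at hA0 hA1
  simp only at hA0 hA1
  have hz : bsumW κ a a' = 0 := (wordPos_eq_iff_bsumW κ haa'.le ha').1 hpos
  -- the length is even, not four (else a window class), hence six: `a = s`, `a' = s + 6`
  have hlen : a = s ∧ a' = s + 6 := by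
    rcases Nat.lt_or_ge a' (a + 5) with hlt | hge
    · -- length four: a window
      have ha4 : a' = a + 4 := by omega
      subst ha4
      have hat : a = s ∨ a = s + 1 ∨ a = s + 2 := by omega
      rcases hat with rfl | rfl | rfl
      · exact absurd (mem_topVec_of_mem_sixRunVec hs ⟨le_rfl, by omega⟩ hκ hpos) h0
      · exact absurd (mem_topVec_of_mem_sixRunVec hs ⟨by omega, by omega⟩ hκ hpos) h1
      · exact absurd (mem_topVec_of_mem_sixRunVec hs ⟨by omega, by omega⟩ hκ hpos) h2
    · rcases Nat.lt_or_ge a' (a + 6) with hlt' | hge'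
      · exfalso; exact bsumW_ne_zero_of_odd κ ha' (by omega) hz
      · constructor <;> omega
  obtain ⟨rfl, rfl⟩ := hlen
  -- partners inside the block
  have opp : ∀ q : Fin m, a ≤ q.val ∧ q.val < a + 6 → ∃ q' : Fin m, (a ≤ q'.val ∧ q'.val < a + 6) ∧ q' ≠ q ∧ OppAt κ q q' :=
    fun q hq => exists_opp_of_bsumW_eq_zero κ hz q hq
  -- no reversal at adjacent positions of the run
  have nadj : ∀ (u : ℕ) (hu : u + 1 < m), a ≤ u → u ≤ a + 4 → ¬ OppAt κ ⟨u, by omega⟩ ⟨u + 1, hu⟩ := by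
    intro u hu h1 h2 h
    exact hnr ⟨u, by omega⟩ hu ((sixRunVec_eq_true_iff _).2 ⟨h1, h2⟩) h
  have nadj' : ∀ (u : ℕ) (hu : u + 1 < m), a ≤ u → u ≤ a + 4 → ¬ OppAt κ ⟨u + 1, hu⟩ ⟨u, by omega⟩ := by
    intro u hu h1 h2 h
    apply nadj u hu h1 h2
    unfold OppAt at h ⊢
    rw [h]; simp
  -- uniqueness of partners
  have uniq : ∀ {u v c : Fin m}, OppAt κ u v → OppAt κ u c → c = v := by
    intro u v c huv huc
    have hc : (κ c).1 = (κ u).1 := by unfold OppAt at huc; rw [huc]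
    rcases eq_or_eq_of_oppAt hm hbase huv hc with h | h
    · subst h; unfold OppAt at huc
      have := congrArg Prod.snd huc
      cases hh : (κ c).2 <;> simp [hh] at this
    · exact h
  have uniq' : ∀ {u v c : Fin m}, OppAt κ u v → OppAt κ c v → c = u := by
    intro u v c huv hcv
    have hsymm : ∀ {x y : Fin m}, OppAt κ x y → OppAt κ y x := by
      intro x y h; unfold OppAt at h ⊢; rw [h]; simp
    exact uniq (hsymm huv) (hsymm hcv)
  -- windows are excluded
  have nwin : ∀ (t : ℕ) (ht4 : t + 4 ≤ m), (t = a ∨ t = a + 1 ∨ t = a + 2) →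
      OppAt κ ⟨t, by omega⟩ ⟨t + 2, by omega⟩ → OppAt κ ⟨t + 1, by omega⟩ ⟨t + 3, by omega⟩ → False := by
    intro t ht4 ht h02 h13
    have hmem := mem_topVec_of_oppAt hm ht4 hbase h02 h13
    rcases ht with rfl | rfl | rfl
    · exact h0 hmem
    · exact h1 hmem
    · exact h2 hmem
  -- partner of `a`
  obtain ⟨p0, hp0r, hp0ne, hp0⟩ := opp ⟨a, hs0⟩ ⟨le_rfl, by simp only; omega⟩
  obtain ⟨p1, hp1r, hp1ne, hp1⟩ := opp ⟨a + 1, hs1⟩ ⟨by simp only; omega, by simp only; omega⟩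
  obtain ⟨p2, hp2r, hp2ne, hp2⟩ := opp ⟨a + 2, hs2⟩ ⟨by simp only; omega, by simp only; omega⟩
  obtain ⟨p3, hp3r, hp3ne, hp3⟩ := opp ⟨a + 3, hs3⟩ ⟨by simp only; omega, by simp only; omega⟩
  -- normal forms of the partners as explicit positions
  have cast : ∀ (p : Fin m) (v : ℕ) (hv : v < m), p.val = v → p = ⟨v, hv⟩ := fun p v hv h => Fin.ext h
  -- `p0 ∈ {a+2, a+3, a+4, a+5}` (not `a+1`: adjacent)
  have hp0v : p0.val = a + 2 ∨ p0.val = a + 3 ∨ p0.val = a + 4 ∨ p0.val = a + 5 := by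
    have hne1 : p0.val ≠ a + 1 := fun h => nadj a hs1 le_rfl (by omega) (by rw [← cast p0 _ hs1 h]; exact hp0)
    have : p0.val ≠ a := fun h => hp0ne (Fin.ext h)
    omega
  -- `p1 ∉ {a, a+1, a+2}`
  have hp1v : p1.val = a + 3 ∨ p1.val = a + 4 ∨ p1.val = a + 5 := by
    have hne0 : p1.val ≠ a := fun h => nadj' a hs1 le_rfl (by omega) (by rw [← cast p1 _ hs0 h]; exact hp1)
    have hne2 : p1.val ≠ a + 2 := fun h => nadj (a + 1) hs2 (by omega) (by omega) (by
      have e : (⟨a + 1 + 1, hs2⟩ : Fin m) = p1 := Fin.ext (by simp only; omega)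
      rw [e]; exact hp1)
    have : p1.val ≠ a + 1 := fun h => hp1ne (Fin.ext h)
    omega
  rcases hp0v with h02 | h03 | h04 | h05
  · -- partner of `a` is `a+2`
    have H02 : OppAt κ ⟨a, hs0⟩ ⟨a + 2, hs2⟩ := by rw [← cast p0 _ hs2 h02]; exact hp0
    rcases hp1v with h13 | h14 | h15
    · exact (nwin a (by omega) (Or.inl rfl) H02 (by rw [← cast p1 _ hs3 h13]; exact hp1)).elim
    · have H14 : OppAt κ ⟨a + 1, hs1⟩ ⟨a + 4, hs4⟩ := by rw [← cast p1 _ hs4 h14]; exact hp1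
      -- partner of `a+3` is `a+5`
      have hp3v : p3.val = a + 5 := by
        have h3ne : p3.val ≠ a + 3 := fun h => hp3ne (Fin.ext h)
        have n0 : p3.val ≠ a := fun h => by
          have := uniq' (show OppAt κ ⟨a + 2, hs2⟩ ⟨a, hs0⟩ by unfold OppAt at H02 ⊢; rw [H02]; simp)
            (show OppAt κ ⟨a + 3, hs3⟩ ⟨a, hs0⟩ by rw [← cast p3 _ hs0 h]; exact hp3)
          simp [Fin.ext_iff] at this
        have n2 : p3.val ≠ a + 2 := fun h => by
          have := uniq' H02 (show OppAt κ ⟨a + 3, hs3⟩ ⟨a + 2, hs2⟩ by rw [← cast p3 _ hs2 h]; exact hp3)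
          simp [Fin.ext_iff] at this
        have n1 : p3.val ≠ a + 1 := fun h => by
          have := uniq' (show OppAt κ ⟨a + 4, hs4⟩ ⟨a + 1, hs1⟩ by unfold OppAt at H14 ⊢; rw [H14]; simp)
            (show OppAt κ ⟨a + 3, hs3⟩ ⟨a + 1, hs1⟩ by rw [← cast p3 _ hs1 h]; exact hp3)
          simp [Fin.ext_iff] at this
        have n4 : p3.val ≠ a + 4 := fun h => by
          have := uniq' H14 (show OppAt κ ⟨a + 3, hs3⟩ ⟨a + 4, hs4⟩ by rw [← cast p3 _ hs4 h]; exact hp3)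
          simp [Fin.ext_iff] at this
        omega
      exact Or.inr (Or.inl ⟨H02, H14, by rw [← cast p3 _ hs5 hp3v]; exact hp3⟩)
    · have H15 : OppAt κ ⟨a + 1, hs1⟩ ⟨a + 5, hs5⟩ := by rw [← cast p1 _ hs5 h15]; exact hp1
      -- partner of `a+3` must be `a+4`: adjacent
      exfalso
      have n3 : p3.val ≠ a + 3 := fun h => hp3ne (Fin.ext h)
      have n0 : p3.val ≠ a := fun h => by
        have := uniq' (show OppAt κ ⟨a + 2, hs2⟩ ⟨a, hs0⟩ by unfold OppAt at H02 ⊢; rw [H02]; simp)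
          (show OppAt κ ⟨a + 3, hs3⟩ ⟨a, hs0⟩ by rw [← cast p3 _ hs0 h]; exact hp3)
        simp [Fin.ext_iff] at this
      have n2 : p3.val ≠ a + 2 := fun h => by
        have := uniq' H02 (show OppAt κ ⟨a + 3, hs3⟩ ⟨a + 2, hs2⟩ by rw [← cast p3 _ hs2 h]; exact hp3)
        simp [Fin.ext_iff] at this
      have n1 : p3.val ≠ a + 1 := fun h => by
        have := uniq' (show OppAt κ ⟨a + 5, hs5⟩ ⟨a + 1, hs1⟩ by unfold OppAt at H15 ⊢; rw [H15]; simp)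
          (show OppAt κ ⟨a + 3, hs3⟩ ⟨a + 1, hs1⟩ by rw [← cast p3 _ hs1 h]; exact hp3)
        simp [Fin.ext_iff] at this
      have n5 : p3.val ≠ a + 5 := fun h => by
        have := uniq' H15 (show OppAt κ ⟨a + 3, hs3⟩ ⟨a + 5, hs5⟩ by rw [← cast p3 _ hs5 h]; exact hp3)
        simp [Fin.ext_iff] at this
      have h34 : p3.val = a + 4 := by omega
      exact nadj (a + 3) hs4 (by omega) (by omega) (by rw [← cast p3 _ hs4 h34]; exact hp3)
  · -- partner of `a` is `a+3`
    have H03 : OppAt κ ⟨a, hs0⟩ ⟨a + 3, hs3⟩ := by rw [← cast p0 _ hs3 h03]; exact hp0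
    have hp1v' : p1.val = a + 4 ∨ p1.val = a + 5 := by
      have n3 : p1.val ≠ a + 3 := fun h => by
        have := uniq' H03 (show OppAt κ ⟨a + 1, hs1⟩ ⟨a + 3, hs3⟩ by rw [← cast p1 _ hs3 h]; exact hp1)
        simp [Fin.ext_iff] at this
      omega
    -- partner of `a+2`
    have n2self : p2.val ≠ a + 2 := fun h => hp2ne (Fin.ext h)
    have n20 : p2.val ≠ a := fun h => by
      have := uniq' (show OppAt κ ⟨a + 3, hs3⟩ ⟨a, hs0⟩ by unfold OppAt at H03 ⊢; rw [H03]; simp)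
        (show OppAt κ ⟨a + 2, hs2⟩ ⟨a, hs0⟩ by rw [← cast p2 _ hs0 h]; exact hp2)
      simp [Fin.ext_iff] at this
    have n23 : p2.val ≠ a + 3 := fun h => nadj (a + 2) hs3 (by omega) (by omega) (by
      have e : (⟨a + 2 + 1, hs3⟩ : Fin m) = p2 := Fin.ext (by simp only; omega)
      rw [e]; exact hp2)
    have n21 : p2.val ≠ a + 1 := fun h => nadj' (a + 1) hs2 (by omega) (by omega) (by
      have e : (⟨a + 1, hs1⟩ : Fin m) = p2 := Fin.ext (by simp only; omega)
      have e' : (⟨a + 1 + 1, hs2⟩ : Fin m) = ⟨a + 2, hs2⟩ := Fin.ext (by simp only)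
      rw [e', e]; exact hp2)
    rcases hp1v' with h14 | h15
    · have H14 : OppAt κ ⟨a + 1, hs1⟩ ⟨a + 4, hs4⟩ := by rw [← cast p1 _ hs4 h14]; exact hp1
      have n24 : p2.val ≠ a + 4 := fun h => by
        have := uniq' H14 (show OppAt κ ⟨a + 2, hs2⟩ ⟨a + 4, hs4⟩ by rw [← cast p2 _ hs4 h]; exact hp2)
        simp [Fin.ext_iff] at this
      have h25 : p2.val = a + 5 := by omega
      exact Or.inl ⟨H03, H14, by rw [← cast p2 _ hs5 h25]; exact hp2⟩
    · have H15 : OppAt κ ⟨a + 1, hs1⟩ ⟨a + 5, hs5⟩ := by rw [← cast p1 _ hs5 h15]; exact hp1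
      have n25 : p2.val ≠ a + 5 := fun h => by
        have := uniq' H15 (show OppAt κ ⟨a + 2, hs2⟩ ⟨a + 5, hs5⟩ by rw [← cast p2 _ hs5 h]; exact hp2)
        simp [Fin.ext_iff] at this
      have h24 : p2.val = a + 4 := by omega
      exact Or.inr (Or.inr (Or.inr ⟨H03, H15, by rw [← cast p2 _ hs4 h24]; exact hp2⟩))
  · -- partner of `a` is `a+4`
    have H04 : OppAt κ ⟨a, hs0⟩ ⟨a + 4, hs4⟩ := by rw [← cast p0 _ hs4 h04]; exact hp0
    have hp1v' : p1.val = a + 3 ∨ p1.val = a + 5 := by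
      have n4 : p1.val ≠ a + 4 := fun h => by
        have := uniq' H04 (show OppAt κ ⟨a + 1, hs1⟩ ⟨a + 4, hs4⟩ by rw [← cast p1 _ hs4 h]; exact hp1)
        simp [Fin.ext_iff] at this
      omega
    have n2self : p2.val ≠ a + 2 := fun h => hp2ne (Fin.ext h)
    have n20 : p2.val ≠ a := fun h => by
      have := uniq' (show OppAt κ ⟨a + 4, hs4⟩ ⟨a, hs0⟩ by unfold OppAt at H04 ⊢; rw [H04]; simp)
        (show OppAt κ ⟨a + 2, hs2⟩ ⟨a, hs0⟩ by rw [← cast p2 _ hs0 h]; exact hp2)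
      simp [Fin.ext_iff] at this
    have n23 : p2.val ≠ a + 3 := fun h => nadj (a + 2) hs3 (by omega) (by omega) (by
      have e : (⟨a + 2 + 1, hs3⟩ : Fin m) = p2 := Fin.ext (by simp only; omega)
      rw [e]; exact hp2)
    have n21 : p2.val ≠ a + 1 := fun h => nadj' (a + 1) hs2 (by omega) (by omega) (by
      have e : (⟨a + 1, hs1⟩ : Fin m) = p2 := Fin.ext (by simp only; omega)
      have e' : (⟨a + 1 + 1, hs2⟩ : Fin m) = ⟨a + 2, hs2⟩ := Fin.ext (by simp only)
      rw [e', e]; exact hp2)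
    have n24 : p2.val ≠ a + 4 := fun h => by
      have := uniq' H04 (show OppAt κ ⟨a + 2, hs2⟩ ⟨a + 4, hs4⟩ by rw [← cast p2 _ hs4 h]; exact hp2)
      simp [Fin.ext_iff] at this
    rcases hp1v' with h13 | h15
    · have H13 : OppAt κ ⟨a + 1, hs1⟩ ⟨a + 3, hs3⟩ := by rw [← cast p1 _ hs3 h13]; exact hp1
      have h25 : p2.val = a + 5 := by omega
      exact Or.inr (Or.inr (Or.inl ⟨H04, H13, by rw [← cast p2 _ hs5 h25]; exact hp2⟩))
    · have H15 : OppAt κ ⟨a + 1, hs1⟩ ⟨a + 5, hs5⟩ := by rw [← cast p1 _ hs5 h15]; exact hp1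
      have n25 : p2.val ≠ a + 5 := fun h => by
        have := uniq' H15 (show OppAt κ ⟨a + 2, hs2⟩ ⟨a + 5, hs5⟩ by rw [← cast p2 _ hs5 h]; exact hp2)
        simp [Fin.ext_iff] at this
      exfalso; omega
  · -- partner of `a` is `a+5`
    have H05 : OppAt κ ⟨a, hs0⟩ ⟨a + 5, hs5⟩ := by rw [← cast p0 _ hs5 h05]; exact hp0
    have hp1v' : p1.val = a + 3 ∨ p1.val = a + 4 := by
      have n5 : p1.val ≠ a + 5 := fun h => by
        have := uniq' H05 (show OppAt κ ⟨a + 1, hs1⟩ ⟨a + 5, hs5⟩ by rw [← cast p1 _ hs5 h]; exact hp1)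
        simp [Fin.ext_iff] at this
      omega
    have n2self : p2.val ≠ a + 2 := fun h => hp2ne (Fin.ext h)
    have n20 : p2.val ≠ a := fun h => by
      have := uniq' (show OppAt κ ⟨a + 5, hs5⟩ ⟨a, hs0⟩ by unfold OppAt at H05 ⊢; rw [H05]; simp)
        (show OppAt κ ⟨a + 2, hs2⟩ ⟨a, hs0⟩ by rw [← cast p2 _ hs0 h]; exact hp2)
      simp [Fin.ext_iff] at this
    have n23 : p2.val ≠ a + 3 := fun h => nadj (a + 2) hs3 (by omega) (by omega) (by
      have e : (⟨a + 2 + 1, hs3⟩ : Fin m) = p2 := Fin.ext (by simp only; omega)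
      rw [e]; exact hp2)
    have n21 : p2.val ≠ a + 1 := fun h => nadj' (a + 1) hs2 (by omega) (by omega) (by
      have e : (⟨a + 1, hs1⟩ : Fin m) = p2 := Fin.ext (by simp only; omega)
      have e' : (⟨a + 1 + 1, hs2⟩ : Fin m) = ⟨a + 2, hs2⟩ := Fin.ext (by simp only)
      rw [e', e]; exact hp2)
    have n25 : p2.val ≠ a + 5 := fun h => by
      have := uniq' H05 (show OppAt κ ⟨a + 2, hs2⟩ ⟨a + 5, hs5⟩ by rw [← cast p2 _ hs5 h]; exact hp2)
      simp [Fin.ext_iff] at this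
    have h24 : p2.val = a + 4 := by omega
    have H24 : OppAt κ ⟨a + 2, hs2⟩ ⟨a + 4, hs4⟩ := by rw [← cast p2 _ hs4 h24]; exact hp2
    rcases hp1v' with h13 | h14
    · -- window `[a+1, a+5)`
      have H13 : OppAt κ ⟨a + 1, hs1⟩ ⟨a + 3, hs3⟩ := by rw [← cast p1 _ hs3 h13]; exact hp1
      exfalso
      exact nwin (a + 1) (by omega) (Or.inr (Or.inl rfl)) H13 H24
    · have := uniq' H24 (show OppAt κ ⟨a + 1, hs1⟩ ⟨a + 4, hs4⟩ by rw [← cast p1 _ hs4 h14]; exact hp1)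
      simp [Fin.ext_iff] at this

/-- ★ A base member with opposite letters along a non-adjacent perfect matching of `[s, s+6)` (pairs given by offsets `aᵢ + 2 ≤ bᵢ ≤ 5`) is a six-run member (`m = 2j`):
adjacent positions carry different axes (no third occurrence) and the six letters sum to zero. [cite: MadrasSlade1993, Definition 1.2.4; lane lemma] -/
theorem hexad_mem_sixRunVec (hm : m = 2 * j) (hs : s + 6 ≤ m) {κ : Word m m} (hκ : κ ∈ baseClass j m) (a₁ b₁ a₂ b₂ a₃ b₃ : ℕ)
    (hb : b₁ ≤ 5 ∧ b₂ ≤ 5 ∧ b₃ ≤ 5) (hgap : a₁ + 2 ≤ b₁ ∧ a₂ + 2 ≤ b₂ ∧ a₃ + 2 ≤ b₃) (hdist : [a₁, b₁, a₂, b₂, a₃, b₃].Nodup)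
    (hcover : ∀ t, t ≤ 5 → t ∈ [a₁, b₁, a₂, b₂, a₃, b₃])
    (h₁ : OppAt κ ⟨s + a₁, by omega⟩ ⟨s + b₁, by omega⟩) (h₂ : OppAt κ ⟨s + a₂, by omega⟩ ⟨s + b₂, by omega⟩)
    (h₃ : OppAt κ ⟨s + a₃, by omega⟩ ⟨s + b₃, by omega⟩) : κ ∈ shapeClass j m (sixRunVec m s) := by
  classical
  have hκ' := hκ
  unfold baseClass at hκ'
  rw [Finset.mem_filter] at hκ'
  obtain ⟨-, hcan, hax, hrep⟩ := hκ'
  simp only [List.nodup_cons, List.mem_cons, List.not_mem_nil, List.nodup_nil, not_or, or_false, and_true] at hdist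
  have hsymm : ∀ {x y : Fin m}, OppAt κ x y → OppAt κ y x := by
    intro x y h; unfold OppAt at h ⊢; rw [h]; simp
  -- the partner of every block position, at distance ≥ 2
  have partner : ∀ t (ht : t < m), s ≤ t → t ≤ s + 5 → ∃ t' : ℕ, ∃ ht' : t' < m, (t + 2 ≤ t' ∨ t' + 2 ≤ t) ∧ OppAt κ ⟨t, ht⟩ ⟨t', ht'⟩ := by
    intro t ht h1 h2
    have hc := hcover (t - s) (by omega)
    simp only [List.mem_cons, List.not_mem_nil, or_false] at hc
    have e : ∀ (c : ℕ) (hc : s + c < m), t - s = c → (⟨t, ht⟩ : Fin m) = ⟨s + c, hc⟩ := fun c hc h => Fin.ext (by simp only; omega)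
    rcases hc with h | h | h | h | h | h
    · exact ⟨s + b₁, by omega, Or.inl (by omega), by rw [e a₁ (by omega) h]; exact h₁⟩
    · exact ⟨s + a₁, by omega, Or.inr (by omega), by rw [e b₁ (by omega) h]; exact hsymm h₁⟩
    · exact ⟨s + b₂, by omega, Or.inl (by omega), by rw [e a₂ (by omega) h]; exact h₂⟩
    · exact ⟨s + a₂, by omega, Or.inr (by omega), by rw [e b₂ (by omega) h]; exact hsymm h₂⟩
    · exact ⟨s + b₃, by omega, Or.inl (by omega), by rw [e a₃ (by omega) h]; exact h₃⟩
    · exact ⟨s + a₃, by omega, Or.inr (by omega), by rw [e b₃ (by omega) h]; exact hsymm h₃⟩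
  rw [mem_shapeClass_iff]
  refine ⟨hcan, hax, hrep, fun k hk hAk heq => ?_, ⟨s, s + 6, by omega, hs, fun k hk hk' => (sixRunVec_eq_true_iff k).2 ⟨hk, by omega⟩, ?_⟩⟩
  · -- a reversal at `(k, k+1)`: `k+1` would be a third position on the axis of `k`
    rw [sixRunVec_eq_true_iff] at hAk
    obtain ⟨t', ht', hgap', hopp⟩ := partner k.val k.isLt hAk.1 (by omega)
    have hc : (κ ⟨k.val + 1, hk⟩).1 = (κ k).1 := by rw [heq]
    rcases eq_or_eq_of_oppAt hm hκ hopp hc with h | h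
    · have := congrArg Fin.val h; simp at this
    · have := congrArg Fin.val h; simp only at this; omega
  · -- the six letters sum to zero
    rw [wordPos_eq_iff_bsumW κ (by omega) hs]
    unfold bsumW
    have hset : (Finset.univ.filter fun p : Fin m => s ≤ p.val ∧ p.val < s + 6) =
        ({⟨s + a₁, by omega⟩, ⟨s + b₁, by omega⟩, ⟨s + a₂, by omega⟩, ⟨s + b₂, by omega⟩, ⟨s + a₃, by omega⟩, ⟨s + b₃, by omega⟩} : Finset (Fin m)) := by
      ext p
      simp only [Finset.mem_filter, Finset.mem_univ, true_and, Finset.mem_insert, Finset.mem_singleton, Fin.ext_iff]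
      constructor
      · intro hp
        have hc := hcover (p.val - s) (by omega)
        simp only [List.mem_cons, List.not_mem_nil, or_false] at hc
        omega
      · intro hp; omega
    rw [hset, Finset.sum_insert (by simp only [Finset.mem_insert, Finset.mem_singleton, Fin.ext_iff]; omega),
      Finset.sum_insert (by simp only [Finset.mem_insert, Finset.mem_singleton, Fin.ext_iff]; omega),
      Finset.sum_insert (by simp only [Finset.mem_insert, Finset.mem_singleton, Fin.ext_iff]; omega),
      Finset.sum_insert (by simp only [Finset.mem_insert, Finset.mem_singleton, Fin.ext_iff]; omega),
      Finset.sum_pair (by simp only [ne_eq, Fin.ext_iff]; omega)]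
    have e1 := twoStepV_add_of_oppAt h₁
    have e2 := twoStepV_add_of_oppAt h₂
    have e3 := twoStepV_add_of_oppAt h₃
    calc twoStepV m (κ ⟨s + a₁, by omega⟩) + (twoStepV m (κ ⟨s + b₁, by omega⟩) + (twoStepV m (κ ⟨s + a₂, by omega⟩) +
        (twoStepV m (κ ⟨s + b₂, by omega⟩) + (twoStepV m (κ ⟨s + a₃, by omega⟩) + twoStepV m (κ ⟨s + b₃, by omega⟩)))))
        = (twoStepV m (κ ⟨s + a₁, by omega⟩) + twoStepV m (κ ⟨s + b₁, by omega⟩)) + (twoStepV m (κ ⟨s + a₂, by omega⟩) +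
          twoStepV m (κ ⟨s + b₂, by omega⟩)) + (twoStepV m (κ ⟨s + a₃, by omega⟩) + twoStepV m (κ ⟨s + b₃, by omega⟩)) := by abel
      _ = 0 := by rw [e1, e2, e3, add_zero, add_zero]

/-- Uniqueness of partners in a base member: two opposite pairs sharing an end coincide (`m = 2j`). [cite: MadrasSlade1993, Definition 1.2.4; lane plumbing] -/
theorem oppAt_unique {j : ℕ} (hm : m = 2 * j) {κ : Word m m} (hκ : κ ∈ baseClass j m) {u v w : Fin m} (h1 : OppAt κ u v) (h2 : OppAt κ u w) :
    w = v := by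
  have hc : (κ w).1 = (κ u).1 := by unfold OppAt at h2; rw [h2]
  rcases eq_or_eq_of_oppAt hm hκ h1 hc with h | h
  · subst h
    unfold OppAt at h2
    have := congrArg Prod.snd h2
    cases hh : (κ w).2 <;> simp [hh] at this
  · exact h

/-- `OppAt` is symmetric. [cite: MadrasSlade1993, Definition 1.2.4; lane plumbing] -/
theorem oppAt_symm {κ : Word m m} {u v : Fin m} (h : OppAt κ u v) : OppAt κ v u := by
  unfold OppAt at h ⊢; rw [h]; simp

open Classical in
/-- ★★ THE HEXAD COUNT: the six-run members in none of the three one-block classes number `4·(2j−7)‼·2^{2j−3}` (`m = 2j`, `j ≥ 3`, `s + 6 ≤ m`) — the four patterns,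
pairwise disjoint, each transported to the reference pattern by a permutation of the six positions. [cite: MadrasSlade1993, Definition 1.2.4; lane theorem] -/
theorem card_hexads (hm : m = 2 * j) (hj : 3 ≤ j) (hs : s + 6 ≤ m) :
    ((shapeClass j m (sixRunVec m s)).filter fun κ => κ ∉ shapeClass j m (topVec m s) ∧ κ ∉ shapeClass j m (topVec m (s + 1)) ∧
        κ ∉ shapeClass j m (topVec m (s + 2))).card = 4 * ((2 * j - 7).doubleFactorial * 2 ^ (2 * j - 3)) := by
  have hs0 : s < m := by omega
  have hs1 : s + 1 < m := by omega
  have hs2 : s + 2 < m := by omega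
  have hs3 : s + 3 < m := by omega
  have hs4 : s + 4 < m := by omega
  have hs5 : s + 5 < m := by omega
  set P0 : Fin m := ⟨s, hs0⟩
  set P1 : Fin m := ⟨s + 1, hs1⟩
  set P2 : Fin m := ⟨s + 2, hs2⟩
  set P3 : Fin m := ⟨s + 3, hs3⟩
  set P4 : Fin m := ⟨s + 4, hs4⟩
  set P5 : Fin m := ⟨s + 5, hs5⟩
  set H1 := (baseClass j m).filter fun κ => OppAt κ P0 P3 ∧ OppAt κ P1 P4 ∧ OppAt κ P2 P5 with hH1
  set H2 := (baseClass j m).filter fun κ => OppAt κ P0 P2 ∧ OppAt κ P1 P4 ∧ OppAt κ P3 P5 with hH2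
  set H3 := (baseClass j m).filter fun κ => OppAt κ P0 P4 ∧ OppAt κ P1 P3 ∧ OppAt κ P2 P5 with hH3
  set H4 := (baseClass j m).filter fun κ => OppAt κ P0 P3 ∧ OppAt κ P1 P5 ∧ OppAt κ P2 P4 with hH4
  -- the permutations and the four counts
  have hswap : ∀ (a b x : ℕ) (ha : a < m) (hb : b < m) (hx : x < m),
      (Equiv.swap (⟨a, ha⟩ : Fin m) ⟨b, hb⟩) ⟨x, hx⟩ = if x = a then ⟨b, hb⟩ else if x = b then ⟨a, ha⟩ else ⟨x, hx⟩ := by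
    intro a b x ha hb hx
    rw [Equiv.swap_apply_def]
    simp only [Fin.ext_iff]
  have c1 : H1.card = (2 * j - 7).doubleFactorial * 2 ^ (2 * j - 3) := by
    rw [hH1, ← card_filter_three_pairs hm hj hs ((Equiv.swap P3 P4).trans (Equiv.swap P2 P3))]
    congr 1
    refine Finset.filter_congr fun κ _ => ?_
    simp only [Equiv.trans_apply, P0, P1, P2, P3, P4, P5, hswap]
    simp
  have c2 : H2.card = (2 * j - 7).doubleFactorial * 2 ^ (2 * j - 3) := by
    rw [hH2, ← card_filter_three_pairs hm hj hs (Equiv.swap P3 P4)]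
    congr 1
    refine Finset.filter_congr fun κ _ => ?_
    simp only [P0, P1, P2, P3, P4, P5, hswap]
    simp
  have c3 : H3.card = (2 * j - 7).doubleFactorial * 2 ^ (2 * j - 3) := by
    rw [hH3, ← card_filter_three_pairs hm hj hs (Equiv.swap P2 P4)]
    congr 1
    refine Finset.filter_congr fun κ _ => ?_
    simp only [P0, P1, P2, P3, P4, P5, hswap]
    simp
  have c4 : H4.card = (2 * j - 7).doubleFactorial * 2 ^ (2 * j - 3) := by
    rw [hH4, ← card_filter_three_pairs hm hj hs (((Equiv.swap P2 P3).trans (Equiv.swap P2 P5)).trans (Equiv.swap P2 P4))]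
    congr 1
    refine Finset.filter_congr fun κ _ => ?_
    simp only [Equiv.trans_apply, P0, P1, P2, P3, P4, P5, hswap]
    simp
  -- the hexads are the union of the four patterns
  have hcover : ∀ t, t ≤ 5 → t ∈ [0, 3, 1, 4, 2, 5] := by intro t ht; simp only [List.mem_cons, List.not_mem_nil, or_false]; omega
  have hcover2 : ∀ t, t ≤ 5 → t ∈ [0, 2, 1, 4, 3, 5] := by intro t ht; simp only [List.mem_cons, List.not_mem_nil, or_false]; omega
  have hcover3 : ∀ t, t ≤ 5 → t ∈ [0, 4, 1, 3, 2, 5] := by intro t ht; simp only [List.mem_cons, List.not_mem_nil, or_false]; omega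
  have hcover4 : ∀ t, t ≤ 5 → t ∈ [0, 3, 1, 5, 2, 4] := by intro t ht; simp only [List.mem_cons, List.not_mem_nil, or_false]; omega
  -- membership of a pattern word in the six-run class and in no window class
  have hexad_in : ∀ κ : Word m m, κ ∈ baseClass j m →
      ((OppAt κ P0 P3 ∧ OppAt κ P1 P4 ∧ OppAt κ P2 P5) ∨ (OppAt κ P0 P2 ∧ OppAt κ P1 P4 ∧ OppAt κ P3 P5) ∨
        (OppAt κ P0 P4 ∧ OppAt κ P1 P3 ∧ OppAt κ P2 P5) ∨ (OppAt κ P0 P3 ∧ OppAt κ P1 P5 ∧ OppAt κ P2 P4)) →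
      κ ∈ shapeClass j m (sixRunVec m s) ∧ κ ∉ shapeClass j m (topVec m s) ∧ κ ∉ shapeClass j m (topVec m (s + 1)) ∧ κ ∉ shapeClass j m (topVec m (s + 2)) := by
    intro κ hκ hpat
    have notwin : ∀ (t : ℕ) (ht : t + 4 ≤ m) (u v : Fin m), (u = ⟨t, by omega⟩ ∨ u = ⟨t + 1, by omega⟩) → OppAt κ u v →
        v ≠ (if u = ⟨t, by omega⟩ then (⟨t + 2, by omega⟩ : Fin m) else ⟨t + 3, by omega⟩) → κ ∉ shapeClass j m (topVec m t) := by
      intro t ht u v hu huv hv hmem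
      obtain ⟨a2, a3, -⟩ := top_block hm hmem ht
      rcases hu with rfl | rfl
      · rw [if_pos rfl] at hv
        exact hv (oppAt_unique hm hκ a2 huv)
      · rw [if_neg (by simp [Fin.ext_iff])] at hv
        exact hv (oppAt_unique hm hκ a3 huv)
    rcases hpat with ⟨h1, h2, h3⟩ | ⟨h1, h2, h3⟩ | ⟨h1, h2, h3⟩ | ⟨h1, h2, h3⟩
    · refine ⟨hexad_mem_sixRunVec hm hs hκ 0 3 1 4 2 5 (by omega) (by omega) (by decide) hcover h1 h2 h3, ?_, ?_, ?_⟩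
      · exact notwin s (by omega) P0 P3 (Or.inl rfl) h1 (by simp [P0, P3, Fin.ext_iff])
      · exact notwin (s + 1) (by omega) P1 P4 (Or.inl rfl) h2 (by simp [P1, P4, Fin.ext_iff])
      · exact notwin (s + 2) (by omega) P2 P5 (Or.inl rfl) h3 (by simp [P2, P5, Fin.ext_iff])
    · refine ⟨hexad_mem_sixRunVec hm hs hκ 0 2 1 4 3 5 (by omega) (by omega) (by decide) hcover2 h1 h2 h3, ?_, ?_, ?_⟩
      · exact notwin s (by omega) P1 P4 (Or.inr rfl) h2 (by simp [P1, P4, Fin.ext_iff])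
      · exact notwin (s + 1) (by omega) P1 P4 (Or.inl rfl) h2 (by simp [P1, P4, Fin.ext_iff])
      · exact notwin (s + 2) (by omega) P2 P0 (Or.inl rfl) (oppAt_symm h1) (by simp [P2, P0, Fin.ext_iff]; omega)
    · refine ⟨hexad_mem_sixRunVec hm hs hκ 0 4 1 3 2 5 (by omega) (by omega) (by decide) hcover3 h1 h2 h3, ?_, ?_, ?_⟩
      · exact notwin s (by omega) P0 P4 (Or.inl rfl) h1 (by simp [P0, P4, Fin.ext_iff])
      · exact notwin (s + 1) (by omega) P2 P5 (Or.inr (by simp [P2])) h3 (by simp [P2, P5, Fin.ext_iff])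
      · exact notwin (s + 2) (by omega) P2 P5 (Or.inl rfl) h3 (by simp [P2, P5, Fin.ext_iff])
    · refine ⟨hexad_mem_sixRunVec hm hs hκ 0 3 1 5 2 4 (by omega) (by omega) (by decide) hcover4 h1 h2 h3, ?_, ?_, ?_⟩
      · exact notwin s (by omega) P0 P3 (Or.inl rfl) h1 (by simp [P0, P3, Fin.ext_iff])
      · exact notwin (s + 1) (by omega) P1 P5 (Or.inl rfl) h2 (by simp [P1, P5, Fin.ext_iff])
      · exact notwin (s + 2) (by omega) P3 P0 (Or.inr (by simp [P3])) (oppAt_symm h1) (by simp [P3, P0, Fin.ext_iff]; omega)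
  have heq : ((shapeClass j m (sixRunVec m s)).filter fun κ => κ ∉ shapeClass j m (topVec m s) ∧ κ ∉ shapeClass j m (topVec m (s + 1)) ∧
      κ ∉ shapeClass j m (topVec m (s + 2))) = H1 ∪ H2 ∪ H3 ∪ H4 := by
    ext κ
    rw [Finset.mem_filter, Finset.mem_union, Finset.mem_union, Finset.mem_union, hH1, hH2, hH3, hH4, Finset.mem_filter, Finset.mem_filter,
      Finset.mem_filter, Finset.mem_filter]
    constructor
    · rintro ⟨hκ, h0, h1, h2⟩
      have hb := mem_baseClass_of_mem hκ
      rcases hexad_patterns hm hs hκ h0 h1 h2 with h | h | h | h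
      · exact Or.inl (Or.inl (Or.inl ⟨hb, h⟩))
      · exact Or.inl (Or.inl (Or.inr ⟨hb, h⟩))
      · exact Or.inl (Or.inr ⟨hb, h⟩)
      · exact Or.inr ⟨hb, h⟩
    · rintro (((⟨hb, h⟩ | ⟨hb, h⟩) | ⟨hb, h⟩) | ⟨hb, h⟩)
      · exact hexad_in κ hb (Or.inl h)
      · exact hexad_in κ hb (Or.inr (Or.inl h))
      · exact hexad_in κ hb (Or.inr (Or.inr (Or.inl h)))
      · exact hexad_in κ hb (Or.inr (Or.inr (Or.inr h)))
  -- pairwise disjointness: two different partners of `s` or of `s + 1`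
  have hdis : ∀ (X Y : Finset (Word m m)) (u v w : Fin m), v ≠ w → (∀ κ ∈ X, κ ∈ baseClass j m ∧ OppAt κ u v) → (∀ κ ∈ Y, OppAt κ u w) → Disjoint X Y := by
    intro X Y u v w hvw hX hY
    rw [Finset.disjoint_left]
    intro κ hκX hκY
    obtain ⟨hb, h1⟩ := hX κ hκX
    exact hvw (oppAt_unique hm hb (hY κ hκY) h1)
  have d12 : Disjoint H1 H2 := hdis H1 H2 P0 P3 P2 (by simp [P2, P3, Fin.ext_iff])
    (fun κ hκ => by rw [hH1, Finset.mem_filter] at hκ; exact ⟨hκ.1, hκ.2.1⟩) (fun κ hκ => by rw [hH2, Finset.mem_filter] at hκ; exact hκ.2.1)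
  have d13 : Disjoint H1 H3 := hdis H1 H3 P0 P3 P4 (by simp [P4, P3, Fin.ext_iff])
    (fun κ hκ => by rw [hH1, Finset.mem_filter] at hκ; exact ⟨hκ.1, hκ.2.1⟩) (fun κ hκ => by rw [hH3, Finset.mem_filter] at hκ; exact hκ.2.1)
  have d14 : Disjoint H1 H4 := hdis H1 H4 P1 P4 P5 (by simp [P4, P5, Fin.ext_iff])
    (fun κ hκ => by rw [hH1, Finset.mem_filter] at hκ; exact ⟨hκ.1, hκ.2.2.1⟩) (fun κ hκ => by rw [hH4, Finset.mem_filter] at hκ; exact hκ.2.2.1)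
  have d23 : Disjoint H2 H3 := hdis H2 H3 P0 P2 P4 (by simp [P2, P4, Fin.ext_iff])
    (fun κ hκ => by rw [hH2, Finset.mem_filter] at hκ; exact ⟨hκ.1, hκ.2.1⟩) (fun κ hκ => by rw [hH3, Finset.mem_filter] at hκ; exact hκ.2.1)
  have d24 : Disjoint H2 H4 := hdis H2 H4 P0 P2 P3 (by simp [P2, P3, Fin.ext_iff])
    (fun κ hκ => by rw [hH2, Finset.mem_filter] at hκ; exact ⟨hκ.1, hκ.2.1⟩) (fun κ hκ => by rw [hH4, Finset.mem_filter] at hκ; exact hκ.2.1)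
  have d34 : Disjoint H3 H4 := hdis H3 H4 P0 P4 P3 (by simp [P4, P3, Fin.ext_iff])
    (fun κ hκ => by rw [hH3, Finset.mem_filter] at hκ; exact ⟨hκ.1, hκ.2.1⟩) (fun κ hκ => by rw [hH4, Finset.mem_filter] at hκ; exact hκ.2.1)
  rw [heq, Finset.card_union_of_disjoint (Finset.disjoint_union_left.2 ⟨Finset.disjoint_union_left.2 ⟨d14, d24⟩, d34⟩),
    Finset.card_union_of_disjoint (Finset.disjoint_union_left.2 ⟨d13, d23⟩), Finset.card_union_of_disjoint d12, c1, c2, c3, c4]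
  ring

end Hexads

/-! ### ★★★ The six-run class count -/

section Count

variable {j s : ℕ}

open Classical in
/-- ★★★ THE SIX-RUN CLASS COUNT (`m = 2j`, `j ≥ 3`, `s + 6 ≤ 2j`): `#shapeClass j (2j) (sixRunVec (2j) s) + 2·(2j−7)‼·2^{2j−3} = 3·(2j−5)‼·2^{2j−2} + 4·(2j−7)‼·2^{2j−3}`
— the three one-block windows (`(2j−5)‼2^{2j−2}` each, the outer two minus their far-end reversal pairs `(2j−7)‼2^{2j−3}`) and the four hexad patterns; `640` per six-run at
`j = 4`, `12288` at `j = 5`. [cite: MadrasSlade1993, Definition 1.2.4; lane theorem] -/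
theorem card_shapeClass_sixRunVec (hj : 3 ≤ j) (hs : s + 6 ≤ 2 * j) :
    (shapeClass j (2 * j) (sixRunVec (2 * j) s)).card + 2 * ((2 * j - 7).doubleFactorial * 2 ^ (2 * j - 3)) =
      3 * ((2 * j - 5).doubleFactorial * 2 ^ (2 * j - 2)) + 4 * ((2 * j - 7).doubleFactorial * 2 ^ (2 * j - 3)) := by
  set six := shapeClass j (2 * j) (sixRunVec (2 * j) s) with hsix
  set T0 := shapeClass j (2 * j) (topVec (2 * j) s) with hT0
  set T1 := shapeClass j (2 * j) (topVec (2 * j) (s + 1)) with hT1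
  set T2 := shapeClass j (2 * j) (topVec (2 * j) (s + 2)) with hT2
  set W0 := T0.filter fun κ => ¬ κ ⟨s + 4 + 1, by omega⟩ = ((κ ⟨s + 4, by omega⟩).1, !(κ ⟨s + 4, by omega⟩).2) with hW0
  set W2 := T2.filter fun κ => ¬ κ ⟨s + 1, by omega⟩ = ((κ ⟨s, by omega⟩).1, !(κ ⟨s, by omega⟩).2) with hW2
  set H := six.filter fun κ => κ ∉ T0 ∧ κ ∉ T1 ∧ κ ∉ T2 with hH
  -- the decomposition
  have hdec : six = W0 ∪ T1 ∪ W2 ∪ H := by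
    ext κ
    rw [Finset.mem_union, Finset.mem_union, Finset.mem_union, hW0, hW2, hH, Finset.mem_filter, Finset.mem_filter, Finset.mem_filter]
    constructor
    · intro hκ
      by_cases h0 : κ ∈ T0
      · exact Or.inl (Or.inl (Or.inl ⟨h0, (mem_sixRunVec_iff_of_mem_topVec_left rfl hs h0).1 hκ⟩))
      · by_cases h1 : κ ∈ T1
        · exact Or.inl (Or.inl (Or.inr h1))
        · by_cases h2 : κ ∈ T2
          · exact Or.inl (Or.inr ⟨h2, (mem_sixRunVec_iff_of_mem_topVec_right rfl hs h2).1 hκ⟩)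
          · exact Or.inr ⟨hκ, h0, h1, h2⟩
    · rintro (((⟨h0, hq⟩ | h1) | ⟨h2, hq⟩) | ⟨hκ, -⟩)
      · exact (mem_sixRunVec_iff_of_mem_topVec_left rfl hs h0).2 hq
      · exact mem_sixRunVec_of_mem_topVec_mid rfl hs h1
      · exact (mem_sixRunVec_iff_of_mem_topVec_right rfl hs h2).2 hq
      · exact hκ
  -- disjointness
  have d01 : Disjoint W0 T1 := Finset.disjoint_of_subset_left (Finset.filter_subset _ _) (disjoint_topVec_topVec_succ rfl (by omega))
  have d02 : Disjoint W0 W2 :=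
    Finset.disjoint_of_subset_left (Finset.filter_subset _ _) (Finset.disjoint_of_subset_right (Finset.filter_subset _ _) (disjoint_topVec_topVec_two rfl hs))
  have d12 : Disjoint T1 W2 := Finset.disjoint_of_subset_right (Finset.filter_subset _ _) (disjoint_topVec_topVec_succ (s := s + 1) rfl (by omega))
  have dH : Disjoint (W0 ∪ T1 ∪ W2) H := by
    rw [Finset.disjoint_left]
    intro κ hκ hκH
    rw [hH, Finset.mem_filter] at hκH
    rcases Finset.mem_union.1 hκ with hκ | hκ
    · rcases Finset.mem_union.1 hκ with hκ | hκ
      · exact hκH.2.1 (Finset.mem_filter.1 hκ).1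
      · exact hκH.2.2.1 hκ
    · exact hκH.2.2.2 (Finset.mem_filter.1 hκ).1
  -- the counts
  have hq0 : SepAdj (2 * j) s (s + 4) := ⟨Or.inr le_rfl, by omega⟩
  have hq2 : SepAdj (2 * j) (s + 2) s := ⟨Or.inl le_rfl, by omega⟩
  have cW0 : W0.card + (2 * j - 7).doubleFactorial * 2 ^ (2 * j - 3) = (2 * j - 5).doubleFactorial * 2 ^ (2 * j - 2) := by
    have h := Finset.card_filter_add_card_filter_not (s := T0) (fun κ => κ ⟨s + 4 + 1, by omega⟩ = ((κ ⟨s + 4, by omega⟩).1, !(κ ⟨s + 4, by omega⟩).2))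
    rw [hT0, card_revPairs_eq_card_revData rfl (by omega) hq0, card_revData rfl hj (by omega) hq0, card_shapeClass_top (by omega)] at h
    rw [hW0, hT0]; omega
  have cT1 : T1.card = (2 * j - 5).doubleFactorial * 2 ^ (2 * j - 2) := card_shapeClass_top (by omega)
  have cW2 : W2.card + (2 * j - 7).doubleFactorial * 2 ^ (2 * j - 3) = (2 * j - 5).doubleFactorial * 2 ^ (2 * j - 2) := by
    have h := Finset.card_filter_add_card_filter_not (s := T2) (fun κ => κ ⟨s + 1, by omega⟩ = ((κ ⟨s, by omega⟩).1, !(κ ⟨s, by omega⟩).2))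
    rw [hT2, card_revPairs_eq_card_revData rfl hs hq2, card_revData rfl hj hs hq2, card_shapeClass_top hs] at h
    rw [hW2, hT2]; omega
  have cH : H.card = 4 * ((2 * j - 7).doubleFactorial * 2 ^ (2 * j - 3)) := card_hexads rfl hj hs
  rw [hdec, Finset.card_union_of_disjoint dH, Finset.card_union_of_disjoint (Finset.disjoint_union_left.2 ⟨d02, d12⟩), Finset.card_union_of_disjoint d01]
  omega

end Count



end WordTypes

end Literature.Probability.RandomPlanarGeometry.SAW.Zd
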